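import Literature.Computability.MetaComplexity.NWStrings
import Literature.Computability.MetaComplexity.NWLexicodeDesigns
import HarnessLib

/-!
# The advice tables of the Nisan–Wigderson reconstruction (description-length accounting)

Topic `Literature/Computability/MetaComplexity`, sequel of `NWStrings.lean`. The point of the designs in
the NW reconstruction (Hirahara 2018 / ECCC TR18-138, proof of Lemma 4.6: "the value of `f` needed in
the computation of `P` can be hardwired into the circuit using `∑_{j<i} 2^{|Sᵢ ∩ Sⱼ|}` bits"): on the
overwritten seed `z_a` (challenge `a` placed on block `Sᵢ`), the real bit `f(z_a|_{Sⱼ})`, `j < i`,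
depends on `a` only through its bits at the coordinates where the words `gᵢ, gⱼ` agree
(`Sᵢ ∩ Sⱼ` in the product universe), hence is a look-up in a table of `2^{|Sᵢ ∩ Sⱼ|}` bits:

* `NWStr.keyPos gᵢ gⱼ` (the agreeing coordinates), `NWStr.keyOf` (the key bits of a challenge),
  `NWStr.spread` (a challenge with prescribed key), `NWStr.rowOf` (the restriction `z_a|_{Sⱼ}` computed
  coordinatewise), `resBits_overwrite` and `rowOf_spread_keyOf` (it depends on the key only);
* `NWStr.tableOf` — the table of `f(z_a|_{Sⱼ})` over all keys, `fAt_resBits_overwrite` (the look-up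
  identity); `NWStr.tables`, `NWStr.offsetOf`, `getD_tables` (the concatenated tables and their
  offsets), **`nwOut_take_overwrite`** (the real part of the hybrid query is a list of look-ups — the form
  a string machine recomputes from the concatenated tables);
* lengths: `length_tableOf`, `length_tables`, `length_keyPos_wordList` (`= agree`, so that the total
  table length of block `i` is the weak-design quantity `∑_{j<i} 2^{agree gᵢ gⱼ}` of Def. 4.3 / Lemma 4.4;
  the bound for a concrete design is proved with the design, e.g. `LineDesigns.lean`).

## References

* S. Hirahara, ECCC TR18-138 (2018), Def. 4.3, Lemma 4.4, Lemma 4.6 and its proof (pp. 15–16).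
* N. Nisan, A. Wigderson, JCSS 49 (1994), Lemma 2.4; R. Raz, O. Reingold, S. Vadhan, JCSS 65 (2002), Lemma 15.
-/

namespace Literature.Computability.MetaComplexity

open Finset Complexity

namespace NWStr

/-! ### Keys -/

/-- The coordinates (in increasing order) where the word `gⱼ` agrees with `gᵢ`: the positions of
`Sᵢ ∩ Sⱼ` inside block `i`. [cite: Hirahara2018, Lemma 4.6 (proof, "`z_{Sᵢ ∩ Sⱼ}`")] -/
def keyPos (gi gj : List ℕ) : List ℕ := (List.range gi.length).filter fun k => gj[k]? = gi[k]?

/-- Key positions are coordinates of block `i`. [folklore] -/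
theorem lt_of_mem_keyPos {gi gj : List ℕ} {k : ℕ} (h : k ∈ keyPos gi gj) : k < gi.length := by
  simp only [keyPos, List.mem_filter, List.mem_range] at h
  exact h.1

/-- Membership in `keyPos`. [folklore] -/
theorem mem_keyPos_iff {gi gj : List ℕ} {k : ℕ} : k ∈ keyPos gi gj ↔ k < gi.length ∧ gj[k]? = gi[k]? := by
  simp [keyPos]

/-- `keyPos` has no duplicates. [folklore] -/
theorem nodup_keyPos (gi gj : List ℕ) : (keyPos gi gj).Nodup := (List.nodup_range).filter _

/-- **The key** of a challenge `a`: its bits at the agreeing coordinates. [cite: Hirahara2018, Lemma 4.6 (proof)] -/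
def keyOf (gi gj : List ℕ) (a : List Bool) : List Bool := (keyPos gi gj).map fun k => a.getD k false

/-- The key has one bit per agreeing coordinate. [folklore] -/
@[simp] theorem length_keyOf (gi gj : List ℕ) (a : List Bool) : (keyOf gi gj a).length = (keyPos gi gj).length := by
  simp [keyOf]

/-- **A challenge with prescribed key** (key bits at the agreeing coordinates, `0` elsewhere).
[folklore] -/
def spread (gi gj : List ℕ) (key : List Bool) : List Bool :=
  (List.range gi.length).map fun k => key.getD ((keyPos gi gj).idxOf k) false

/-- Bits of `spread`. [folklore] -/
theorem getD_spread (gi gj : List ℕ) (key : List Bool) {k : ℕ} (hk : k < gi.length) :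
    (spread gi gj key).getD k false = key.getD ((keyPos gi gj).idxOf k) false := by
  rw [spread, List.getD_eq_getElem _ _ (by simpa using hk)]
  simp

/-- The key of a spread key is the key. [folklore] -/
theorem keyOf_spread (gi gj : List ℕ) (key : List Bool) (hkey : key.length = (keyPos gi gj).length) :
    keyOf gi gj (spread gi gj key) = key := by
  apply List.ext_getElem
  · rw [length_keyOf, hkey]
  · intro t h1 h2
    simp only [keyOf, List.getElem_map]
    have hmem : (keyPos gi gj)[t]'(by simpa using h1) ∈ keyPos gi gj := List.getElem_mem _
    rw [getD_spread gi gj key (lt_of_mem_keyPos hmem), (nodup_keyPos gi gj).idxOf_getElem _ (by simpa using h1),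
      List.getD_eq_getElem _ _ h2]

/-! ### The restriction of the overwritten seed to another block -/

/-- The restriction `z_a|_{Sⱼ}` computed coordinatewise: at an agreeing coordinate the challenge bit,
elsewhere the seed bit. [cite: Hirahara2018, Lemma 4.6 (proof)] -/
def rowOf (b : ℕ) (gi gj : List ℕ) (z a : List Bool) : List Bool :=
  gj.mapIdx fun k v => if gi[k]? = some v then a.getD k false else z.getD (k * b + v) false

/-- Length of `rowOf`. [folklore] -/
@[simp] theorem length_rowOf (b : ℕ) (gi gj : List ℕ) (z a : List Bool) : (rowOf b gi gj z a).length = gj.length := by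
  simp [rowOf]

/-- **`z_a|_{Sⱼ}` is `rowOf`** for a well-formed word `gⱼ` (symbols `< b`) and a seed of length `ℓ b`.
[cite: Hirahara2018, Lemma 4.6 (proof)] -/
theorem resBits_overwrite (b : ℕ) {ℓ : ℕ} (gi gj : List ℕ) (z a : List Bool) (hgj : gj.length = ℓ) (hsym : ∀ v ∈ gj, v < b)
    (hz : z.length = ℓ * b) : resBits b gj (overwrite b gi z a) = rowOf b gi gj z a := by
  apply List.ext_getElem
  · simp
  · intro k h1 h2
    have hk : k < ℓ := by simpa [hgj] using h1
    have hv : gj[k]'(by simpa using h1) < b := hsym _ (List.getElem_mem _)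
    have hb : 0 < b := (Nat.zero_le _).trans_lt hv
    rw [getElem_resBits, getD_overwrite _ _ _ _ _ (by rw [hz]; exact pos_lt hk hv)]
    have hdiv : (k * b + gj[k]'(by simpa using h1)) / b = k := by
      rw [Nat.add_comm, Nat.add_mul_div_right _ _ hb, Nat.div_eq_of_lt hv, Nat.zero_add]
    have hmod : (k * b + gj[k]'(by simpa using h1)) % b = gj[k]'(by simpa using h1) := by
      rw [Nat.add_comm, Nat.add_mul_mod_self_right, Nat.mod_eq_of_lt hv]
    rw [hdiv, hmod]
    simp [rowOf]

/-- **`rowOf` depends on the challenge only through its key.** [cite: Hirahara2018, Lemma 4.6 (proof: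
"indexed by `(j, z_{Sᵢ∩Sⱼ})`")] -/
theorem rowOf_spread_keyOf (b : ℕ) (gi gj : List ℕ) (z a : List Bool) (hlen : gj.length = gi.length) :
    rowOf b gi gj z (spread gi gj (keyOf gi gj a)) = rowOf b gi gj z a := by
  apply List.ext_getElem
  · simp
  · intro k h1 h2
    have hk : k < gi.length := by rw [← hlen]; simpa using h1
    simp only [rowOf, List.getElem_mapIdx]
    split_ifs with h
    · -- an agreeing coordinate: the spread key carries `a_k`
      have hmem : k ∈ keyPos gi gj := by
        rw [mem_keyPos_iff]
        exact ⟨hk, by rw [h, List.getElem?_eq_getElem (by simpa using h1)]⟩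
      rw [getD_spread gi gj _ hk, keyOf, List.getD_eq_getElem _ _ (by simpa using List.idxOf_lt_length_of_mem hmem)]
      simp only [List.getElem_map, List.getElem_idxOf (List.idxOf_lt_length_of_mem hmem)]
    · rfl

/-! ### Tables and look-ups -/

/-- **The table of block `j` for block `i`**: `f(z_a|_{Sⱼ})` for every key (`2^{|Sᵢ∩Sⱼ|}` bits).
[cite: Hirahara2018, Lemma 4.6 (proof, "the hardwired table of the values of `f`")] -/
def tableOf (b : ℕ) (f : List Bool) (gi gj : List ℕ) (z : List Bool) : List Bool :=
  List.ofFn fun v : Fin (2 ^ (keyPos gi gj).length) => fAt f (rowOf b gi gj z (spread gi gj (natBits (keyPos gi gj).length v)))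

/-- A table has `2^{|Sᵢ∩Sⱼ|}` bits. [cite: Hirahara2018, Lemma 4.6 (proof)] -/
@[simp] theorem length_tableOf (b : ℕ) (f : List Bool) (gi gj : List ℕ) (z : List Bool) :
    (tableOf b f gi gj z).length = 2 ^ (keyPos gi gj).length := by
  simp [tableOf]

/-- **The look-up identity**: `f(z_a|_{Sⱼ})` is the table entry at the value of the key of `a`.
[cite: Hirahara2018, Lemma 4.6 (proof)] -/
theorem fAt_resBits_overwrite (b : ℕ) {ℓ : ℕ} (f : List Bool) (gi gj : List ℕ) (z a : List Bool) (hgi : gi.length = ℓ)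
    (hgj : gj.length = ℓ) (hsym : ∀ v ∈ gj, v < b) (hz : z.length = ℓ * b) :
    fAt f (resBits b gj (overwrite b gi z a)) = (tableOf b f gi gj z).getD (bitsToNat (keyOf gi gj a)) false := by
  have hlt : bitsToNat (keyOf gi gj a) < 2 ^ (keyPos gi gj).length := by simpa using bitsToNat_lt (keyOf gi gj a)
  rw [tableOf, Kannan.getD_ofFn _ hlt]
  dsimp only
  rw [show natBits (keyPos gi gj).length (bitsToNat (keyOf gi gj a)) = keyOf gi gj a by
      simpa using CoinEnum.natBits_bitsToNat (keyOf gi gj a),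
    rowOf_spread_keyOf b gi gj z a (by rw [hgi, hgj]), resBits_overwrite b gi gj z a hgj hsym hz]

/-- **The concatenated tables** of block `i`: the tables of the blocks `j < i`, in order.
[cite: Hirahara2018, Lemma 4.6 (proof)] -/
def tables (b : ℕ) (f : List Bool) (D : List (List ℕ)) (i : ℕ) (z : List Bool) : List Bool :=
  ((D.take i).map fun gj => tableOf b f (D.getD i []) gj z).flatten

/-- **The offset** of the table of block `j` inside the concatenated tables of block `i`. [folklore] -/
def offsetOf (D : List (List ℕ)) (i j : ℕ) : ℕ := ((D.take j).map fun gj => 2 ^ (keyPos (D.getD i []) gj).length).sum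

/-- Reading a concatenation at an offset (general lists). [folklore] -/
theorem getD_flatten_offset {α : Type*} (d : α) : ∀ (L : List (List α)) (j p : ℕ) (hj : j < L.length),
    p < (L[j]).length → L.flatten.getD (((L.take j).map List.length).sum + p) d = (L[j]).getD p d
  | [], j, p, hj, _ => absurd hj (Nat.not_lt_zero _)
  | l :: L, 0, p, _, hp => by
    simp only [List.take_zero, List.map_nil, List.sum_nil, Nat.zero_add, List.flatten_cons, List.getElem_cons_zero] at hp ⊢
    exact List.getD_append _ _ _ _ hp
  | l :: L, j + 1, p, hj, hp => by
    simp only [List.take_succ_cons, List.map_cons, List.sum_cons, List.flatten_cons, List.getElem_cons_succ] at hp ⊢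
    rw [Nat.add_assoc, List.getD_append_right _ _ _ _ (Nat.le_add_right _ _), Nat.add_sub_cancel_left]
    exact getD_flatten_offset d L j p (by simpa using hj) hp

/-- The total length of the concatenated tables is the last offset. [folklore] -/
theorem length_tables (b : ℕ) (f : List Bool) (D : List (List ℕ)) (i : ℕ) (z : List Bool) :
    (tables b f D i z).length = offsetOf D i i := by
  rw [tables, List.length_flatten, List.map_map, offsetOf]
  congr 1
  exact List.map_congr_left fun gj _ => by simp

/-- **Reading the table of block `j < i` inside the concatenated tables.** [cite: Hirahara2018, Lemma 4.6 (proof)] -/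
theorem getD_tables (b : ℕ) (f : List Bool) (D : List (List ℕ)) {i j : ℕ} (hji : j < i) (hi : i ≤ D.length) (z : List Bool) {p : ℕ}
    (hp : p < 2 ^ (keyPos (D.getD i []) (D[j]'(hji.trans_le hi))).length) :
    (tables b f D i z).getD (offsetOf D i j + p) false = (tableOf b f (D.getD i []) (D[j]'(hji.trans_le hi)) z).getD p false := by
  set L := (D.take i).map fun gj => tableOf b f (D.getD i []) gj z with hL
  have hjL : j < L.length := by simp only [hL, List.length_map, List.length_take]; omega
  have hLj : L[j] = tableOf b f (D.getD i []) (D[j]'(hji.trans_le hi)) z := by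
    simp [hL, List.getElem_take]
  have hoff : offsetOf D i j = ((L.take j).map List.length).sum := by
    rw [offsetOf, hL, ← List.map_take, List.map_map, List.take_take, min_eq_left hji.le]
    congr 1
    exact List.map_congr_left fun gj _ => by simp
  rw [tables, ← hL, hoff, getD_flatten_offset false L j p hjL (by rw [hLj, length_tableOf]; exact hp), hLj]

/-- Well-formed designs: words of length `ℓ` with symbols `< b`. [folklore] -/
def WF (ℓ b : ℕ) (D : List (List ℕ)) : Prop := ∀ g ∈ D, g.length = ℓ ∧ ∀ v ∈ g, v < b

/-- Listed typed designs are well formed. [folklore] -/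
theorem wf_ofFn_wordList {ℓ b m : ℕ} (G : Fin m → (Fin ℓ → Fin b)) : WF ℓ b (List.ofFn fun j => wordList (G j)) := by
  intro g hg
  rw [List.mem_ofFn] at hg
  obtain ⟨j, rfl⟩ := hg
  refine ⟨length_wordList _, fun v hv => ?_⟩
  simp only [wordList, List.mem_ofFn] at hv
  obtain ⟨k, rfl⟩ := hv
  exact (G j k).isLt

/-- **The real part of the hybrid query is a list of look-ups** in the concatenated tables (well-formed
design, `i < |D|`, seed of length `ℓ b`). [cite: Hirahara2018, Lemma 4.6 (proof)] -/
theorem nwOut_take_overwrite {ℓ b : ℕ} (f : List Bool) (D : List (List ℕ)) (hD : WF ℓ b D) {i : ℕ} (hi : i < D.length)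
    (z a : List Bool) (hz : z.length = ℓ * b) :
    nwOut b f (D.take i) (overwrite b (D.getD i []) z a) =
      (List.range i).map fun j => (tables b f D i z).getD (offsetOf D i j + bitsToNat (keyOf (D.getD i []) (D.getD j []) a)) false := by
  have hgi : (D.getD i []).length = ℓ := by
    rw [List.getD_eq_getElem _ _ hi]; exact (hD _ (List.getElem_mem _)).1
  apply List.ext_getElem
  · simp [hi.le]
  · intro j h1 h2
    have hji : j < i := by simpa using h2
    have hjD : j < D.length := hji.trans hi
    have hDj : D.getD j [] = D[j] := List.getD_eq_getElem _ _ hjD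
    obtain ⟨hgj, hsym⟩ := hD _ (List.getElem_mem hjD)
    simp only [nwOut, List.getElem_map, List.getElem_take, List.getElem_range, hDj]
    rw [fAt_resBits_overwrite b f (D.getD i []) (D[j]) z a hgi hgj hsym hz,
      getD_tables b f D hji hi.le z (by simpa using bitsToNat_lt (keyOf (D.getD i []) D[j] a))]

/-! ### Lengths -/

/-- For listed typed words the number of agreeing coordinates is `agree`. [folklore] -/
theorem length_keyPos_wordList {ℓ b : ℕ} (gi gj : Fin ℓ → Fin b) : (keyPos (wordList gi) (wordList gj)).length = agree gi gj := by
  rw [keyPos, agree, length_wordList]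
  rw [← List.toFinset_card_of_nodup ((List.nodup_range).filter _)]
  refine Finset.card_bij (fun k hk => ⟨k, ?_⟩) (fun k hk => ?_) (fun k₁ hk₁ k₂ hk₂ h => by simpa using congrArg Fin.val h)
    (fun k hk => ⟨k, ?_, rfl⟩)
  · simp only [List.mem_toFinset, List.mem_filter, List.mem_range] at hk
    exact hk.1
  · simp only [List.mem_toFinset, List.mem_filter, List.mem_range, decide_eq_true_eq] at hk
    obtain ⟨hk, h⟩ := hk
    simp only [mem_filter, mem_univ, true_and]
    rw [List.getElem?_eq_getElem (by simpa using hk), List.getElem?_eq_getElem (by simpa using hk), getElem_wordList, getElem_wordList,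
      Option.some_inj] at h
    exact Fin.ext h.symm
  · simp only [mem_filter, mem_univ, true_and] at hk
    simp only [List.mem_toFinset, List.mem_filter, List.mem_range, decide_eq_true_eq]
    refine ⟨k.isLt, ?_⟩
    rw [List.getElem?_eq_getElem (by simp), List.getElem?_eq_getElem (by simp), getElem_wordList, getElem_wordList]
    exact congrArg _ (congrArg Fin.val hk).symm

end NWStr

end Literature.Computability.MetaComplexity
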